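import Summits.BirchSwinnertonDyer.BirchSwinnertonDyer.Theorems.SignedLowerHalvesKobayashiLowerHalfLargeImageKuriharaRigidityFWCut
import Summits.BirchSwinnertonDyer.BirchSwinnertonDyer.Theorems.SignedLowerHalvesKobayashiLowerHalfLargeImageKuriharaRigidityThm74ConverseOfFacts
import Summits.BirchSwinnertonDyer.BirchSwinnertonDyer.Theorems.SignedLowerHalvesKobayashiLowerHalfLargeImageKuriharaRigidityThreeOfFacts
import Summits.BirchSwinnertonDyer.BirchSwinnertonDyer.Theorems.SignedLowerHalvesKobayashiLowerHalfLargeImageKuriharaRigidityFouquetWanKatoFrameOfFacts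
import HarnessLib

/-!
# Crux `KobayashiLowerHalfLargeImage` (item stmt-BirchSwinnertonDyer-19001), line `kurihara_rigidity`: the OFF-LOCUS
# EQUIVALENCE and the lead gen 2's FINAL composition (`…FWCut`, p616002) ON PACKAGE-LEVEL NAMED INPUTS ONLY — 0 composite
# binders on the line's last theorem (cell `bsd-ssimc`, seat `bsd-line-slh-p1-w2` g3; `--supports … --as helper`)

WHAT. The lead's `…KuriharaRigidityFWCut` (p616002) cut the line's HARD stub (the `≤` half of Kim's Conjecture 1.10 on the
large-image corner of X7, `p ≥ 5`) and the `p = 3` residue by the Fouquet–Wan locus «∃ ℓ ≠ p prime, multiplicative,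
non-split, `p ∤ ord_ℓ(Δ_min)`», and composed the crux BY NAME from EIGHT binders — four of them COMPOSITES «… ∘ Kobayashi
Thm 7.4» (`Kim2026_thm111_via_kobayashi74`, `CastellaSano2026_thm1_via_kobayashi74_OPEN`,
`Kobayashi74_CastellaSano2026_kimTamagawaDefect_of_signedMC_OPEN`, `KimKimSun2020_thm11_via_kobayashi74_three`,
`FouquetWan2021_thm51_via_kobayashi74_OPEN`) — plus three OPEN statements. This file:

* §1 `kimTamagawaDefect_X7_iff_offLocus_of_fw51_of_converse_OPEN`, `le_half_X7_iff_offLocus_of_fw51_of_converse_OPEN`,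
  `three_iff_offLocus_of_fw51_OPEN`: modulo {`hFW`, `hC`, `h5`} Kim's identity (resp. the registered HARD stub's statement;
  resp. the crux's conclusion at `p = 3`, modulo `hFW` alone) on the WHOLE corner is EQUIVALENT to its restriction to the
  pairs OFF the Fouquet–Wan locus (⟸ = the lead's excluded middle; ⟹ = restriction) — nothing is lost by keying the
  promoted child «off the FW locus» (LEAD report v2, remark on C1).
* §2 `kobayashiLowerHalfLargeImage_iff_offLocus_of_fw51_OPEN`: THE OFF-LOCUS EQUIVALENCE — the crux BY NAME ⟺ (Kim's
  Conjecture 1.10 for the newform of every X7 ∧ ¬CM ∧ `a_p = 0` ∧ Surj pair at `p ≥ 5` OFF the locus) ∧ (the crux's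
  conclusion at the X7@3 ∧ ¬CM ∧ `a₃ = 0` ∧ Surj pairs OFF the locus), modulo the lead's equivalence inputs (p609449) + `hFW`;
  and `…_of_facts`: the same on PACKAGE-LEVEL inputs (CS Thm 1 both directions on the `η = 1` package, the package fact,
  Pollack, modularity, Ko 1.2 / 4.1, FW Thm 5.1 on the package, the period facts) — Kobayashi 7.4 in the kernel both ways.
* §3 `kobayashiLowerHalfLargeImage_of_packageFacts_of_offLocus_OPEN`: p616002's crux-by-name composition with EVERY composite
  binder fed from this seat's `_of_facts` derivations (g0 p608428 Kim 1.11 / CS forward; g2 p611834-ConverseOfFacts CS converse;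
  g2 `…ThreeOfFacts` KKS@3; g2 p613756 FW 5.1) — the crux BY NAME ⟸ PACKAGE-LEVEL statements {Kim 2026 Thm 1.11 (1) ⟹ (3)
  [PUB], Castella–Sano Thm 1 (i) ⟹ (ii) and (ii) ⟹ (i) [PRE claims], the CS §2 `≥` reading [PRE], KKS Thm 1.1 at `3`
  [claim-grade, binder of record p614127 per pen ruling R-X8], FW Thm 5.1 [PRE claim], Kobayashi's package fact, Pollack,
  modularity, Kobayashi Thm 1.2, the period facts at `p ≥ 5` / `p = 3` [PUB]} + OPEN {`hLeOff`: the `≤` half of Kim's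
  Conjecture 1.10 at the X7 ∧ ¬CM ∧ Surj ∧ `p ≥ 5` pairs OFF the FW locus; `hU`: Kurihara's conjecture at `3` on the rows
  X7@3 ∧ ¬CM ∧ Surj ∧ (Tam)₁ ∧ `3 ∤ ∏ c_ℓ`; `hR`: the crux at the X7@3 pairs off those rows AND off the locus}.
  0 composite binders; Kobayashi Thm 7.4 is a kernel step at every odd `p` (`…Thm74` g0, `…Thm74Odd` lead g2,
  `…Thm74Converse` g2).

HONEST FRAMING (cell `bsd-ssimc`, D-0036/D-0074): TOOL THEOREMS ONLY — no definition, no named fact minted, no `sorry`,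
axioms standard; CONDITIONAL on the displayed named facts / PREPRINT claims and on the OPEN statements; the class-wide crux,
the line's HARD stub (promoted by the lead), `stub_three` and the route are NOT closed; nothing is booked; BSD is not proved
by any of this. `--supports stmt-BirchSwinnertonDyer-19001 --as helper`.

References: [Kim2022StructureSelmer] Thm 1.11, Conj 1.10; [CastellaSano2026] Thm 1, §2 (PRE); [KimKimSun2020] Thm 1.1;
[FouquetWan2021] Thm 5.1 (PRE); [Kobayashi2003] Thm 1.2, 4.1, 6.2–6.3, 7.3–7.4; [Pollack2003] Cor 5.11, Prop 6.18;
[GreenbergVatsal2000] §3 Rem 3.4; [Mazur1978] Cor 4.1; [Serre1972] Prop 12; W-lev-9 audit (FW locus reading).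
-/

set_option autoImplicit false
-- single-problem summit (D-0017): the doubled namespace component is by design
set_option linter.dupNamespace false

noncomputable section

open scoped Classical MatrixGroups ModularForm

open CongruenceSubgroup Field WeierstrassCurve Literature.NumberTheory.EllipticCurves
  Literature.NumberTheory.EllipticCurves.ModularForms Literature.NumberTheory.GaloisRepresentations
  Literature.NumberTheory.EllipticCurves.Rank1Residual Summit.BirchSwinnertonDyer.Rank1Residual.Supersingular
  Summit.BirchSwinnertonDyer.Rank1Residual.X4

namespace Summit.BirchSwinnertonDyer.BirchSwinnertonDyer.Theorems.KuriharaRigidity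

/-! ## §1 Nothing is lost off the locus: the three restriction equivalences -/

/-- **Kim's identity on the whole large-image corner of X7 (`p ≥ 5`) ⟺ Kim's identity OFF the Fouquet–Wan locus**,
GRANTED the FW binder `hFW` (FW Thm 5.1 ∘ Ko 7.4, PRE: on the locus both signed main conjectures hold), the converse
binder `hC` (Ko 7.4 ∘ CS Thm 1 (ii) ⟹ (i), PRE: a signed main conjecture ⟹ Kim's identity) and the period fact `h5`.
(⟹) restriction; (⟸) excluded middle on the locus. CONDITIONAL; closes nothing.
[claim: FouquetWan2021, status: under-review] [claim: CastellaSano2026, status: under-review]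
[cite: Kobayashi2003, Thm. 7.4 (p. 13)] [cite: Kim2022StructureSelmer, Conj. 1.10 (PDF p. 8)] -/
theorem kimTamagawaDefect_X7_iff_offLocus_of_fw51_of_converse_OPEN
    (hFW : FouquetWan2021_thm51_via_kobayashi74_OPEN)
    (hC : Kobayashi74_CastellaSano2026_kimTamagawaDefect_of_signedMC_OPEN)
    (h5 : realPeriodRat_eq_unit_mul_plusPeriod) :
    (∀ (W : WeierstrassCurve ℚ) [W.IsElliptic] [W.IsGloballyMinimal] (p : ℕ) [Fact p.Prime],
        5 ≤ p → ClassX7 W p → ¬ W.HasCM → W.frobeniusTrace p = 0 → Surj W p →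
        ∀ [NeZero (W.conductorNorm ℤ)] (f : CuspForm (Gamma0 (W.conductorNorm ℤ)) 2),
          IsNewformOf W f → KimTamagawaDefectAt W p f) ↔
      (∀ (W : WeierstrassCurve ℚ) [W.IsElliptic] [W.IsGloballyMinimal] (p : ℕ) [Fact p.Prime],
        5 ≤ p → ClassX7 W p → ¬ W.HasCM → W.frobeniusTrace p = 0 → Surj W p →
        ¬ (∃ (ℓ : ℕ) (_ : Fact ℓ.Prime), ℓ ≠ p ∧ W.HasMultiplicativeReductionAtPrime ℓ ∧
            ¬ W.HasSplitMultiplicativeReductionAtPrime ℓ ∧ ¬ p ∣ padicValInt ℓ W.minimalDiscriminantInt) →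
        ∀ [NeZero (W.conductorNorm ℤ)] (f : CuspForm (Gamma0 (W.conductorNorm ℤ)) 2),
          IsNewformOf W f → KimTamagawaDefectAt W p f) := by
  constructor
  · intro h W _ _ p _ hp5 hX hcm hap hs _ _ f hf
    exact h W p hp5 hX hcm hap hs f hf
  · intro h W _ _ p _ hp5 hX hcm hap hs _ f hf
    by_cases hloc : ∃ (ℓ : ℕ) (_ : Fact ℓ.Prime), ℓ ≠ p ∧ W.HasMultiplicativeReductionAtPrime ℓ ∧
        ¬ W.HasSplitMultiplicativeReductionAtPrime ℓ ∧ ¬ p ∣ padicValInt ℓ W.minimalDiscriminantInt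
    · have hp2 : p ≠ 2 := by omega
      exact Summit.BirchSwinnertonDyer.Rank1Residual.Supersingular.KuriharaRigidity.kimTamagawaDefectAt_of_signedMC
        hC h5 W p hp5 hX.1.1 hap hcm hs (hFW W p hp2 hX.1.1 hap (ClassX7.irr W p hp2 hX) hloc 1) f hf
    · exact h W p hp5 hX hcm hap hs hloc f hf

/-- **The registered HARD stub `stub_kuriharaPartialInfty_le_tamagawa_X7` (its statement verbatim) ⟺ the `≤` half of
Kim's Conjecture 1.10 OFF the Fouquet–Wan locus**, GRANTED `hFW`, `hC`, `h5`: (⟸) is the lead's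
`le_half_X7_of_fw51_of_converse_OPEN_of_offLocus` (p616002); (⟹) is restriction. So the promoted child C1 may be keyed
«off the FW locus» without loss, modulo two PREPRINT binders. CONDITIONAL; closes nothing.
[claim: FouquetWan2021, status: under-review] [claim: CastellaSano2026, status: under-review]
[cite: Kim2022StructureSelmer, Conj. 1.10 (PDF p. 8)] -/
theorem le_half_X7_iff_offLocus_of_fw51_of_converse_OPEN
    (hFW : FouquetWan2021_thm51_via_kobayashi74_OPEN)
    (hC : Kobayashi74_CastellaSano2026_kimTamagawaDefect_of_signedMC_OPEN)
    (h5 : realPeriodRat_eq_unit_mul_plusPeriod) :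
    (∀ (W : WeierstrassCurve ℚ) [W.IsElliptic] [W.IsGloballyMinimal] (p : ℕ) [Fact p.Prime],
        5 ≤ p → ClassX7 W p → ¬ W.HasCM → W.frobeniusTrace p = 0 → Surj W p →
        ∀ [NeZero (W.conductorNorm ℤ)] (f : CuspForm (Gamma0 (W.conductorNorm ℤ)) 2),
          IsNewformOf W f → kuriharaPartialInfty W p f ≤ (padicValNat p W.tamagawaProduct : ℕ∞)) ↔
      (∀ (W : WeierstrassCurve ℚ) [W.IsElliptic] [W.IsGloballyMinimal] (p : ℕ) [Fact p.Prime],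
        5 ≤ p → ClassX7 W p → ¬ W.HasCM → W.frobeniusTrace p = 0 → Surj W p →
        ¬ (∃ (ℓ : ℕ) (_ : Fact ℓ.Prime), ℓ ≠ p ∧ W.HasMultiplicativeReductionAtPrime ℓ ∧
            ¬ W.HasSplitMultiplicativeReductionAtPrime ℓ ∧ ¬ p ∣ padicValInt ℓ W.minimalDiscriminantInt) →
        ∀ [NeZero (W.conductorNorm ℤ)] (f : CuspForm (Gamma0 (W.conductorNorm ℤ)) 2),
          IsNewformOf W f → KimTamagawaDefectLeAt W p f) := by
  constructor
  · intro h W _ _ p _ hp5 hX hcm hap hs _ _ f hf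
    exact h W p hp5 hX hcm hap hs f hf
  · exact le_half_X7_of_fw51_of_converse_OPEN_of_offLocus hFW hC h5

/-- **The crux's conclusion at `p = 3` on the whole corner ⟺ the same OFF the Fouquet–Wan locus**, GRANTED the FW binder
`hFW` alone (on the locus `X7.kobayashiLowerDivisibility_of_thm51_OPEN` gives the Eisenstein half at `3` directly —
flag A-KATO-3 of the W-lev-9 audit rides with the binder). CONDITIONAL; closes nothing.
[claim: FouquetWan2021, status: under-review] [cite: Kobayashi2003, Thm. 7.4 (p. 13) and Conjecture (p. 2)] -/
theorem three_iff_offLocus_of_fw51_OPEN (hFW : FouquetWan2021_thm51_via_kobayashi74_OPEN) :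
    (∀ (W : WeierstrassCurve ℚ) [W.IsElliptic] [W.IsGloballyMinimal] (p : ℕ) [Fact p.Prime],
        p = 3 → ClassX7 W p → ¬ W.HasCM → W.frobeniusTrace p = 0 → Surj W p →
        ∃ ε : ℤˣ, KobayashiLowerDivisibility W p ε) ↔
      (∀ (W : WeierstrassCurve ℚ) [W.IsElliptic] [W.IsGloballyMinimal] (p : ℕ) [Fact p.Prime],
        p = 3 → ClassX7 W p → ¬ W.HasCM → W.frobeniusTrace p = 0 → Surj W p →
        ¬ (∃ (ℓ : ℕ) (_ : Fact ℓ.Prime), ℓ ≠ p ∧ W.HasMultiplicativeReductionAtPrime ℓ ∧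
            ¬ W.HasSplitMultiplicativeReductionAtPrime ℓ ∧ ¬ p ∣ padicValInt ℓ W.minimalDiscriminantInt) →
        ∃ ε : ℤˣ, KobayashiLowerDivisibility W p ε) := by
  constructor
  · intro h W _ _ p _ hp3 hX hcm hap hs _
    exact h W p hp3 hX hcm hap hs
  · intro h W _ _ p _ hp3 hX hcm hap hs
    by_cases hloc : ∃ (ℓ : ℕ) (_ : Fact ℓ.Prime), ℓ ≠ p ∧ W.HasMultiplicativeReductionAtPrime ℓ ∧
        ¬ W.HasSplitMultiplicativeReductionAtPrime ℓ ∧ ¬ p ∣ padicValInt ℓ W.minimalDiscriminantInt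
    · exact X7.kobayashiLowerDivisibility_of_thm51_OPEN W p hFW (by omega) hX hap hloc
    · exact h W p hp3 hX hcm hap hs hloc

/-! ## §2 THE OFF-LOCUS EQUIVALENCE (and its statement on package-level inputs) -/

/-- **THE OFF-LOCUS EQUIVALENCE of line `kurihara_rigidity`.** Modulo the lead's equivalence inputs (p609449: `hCS` CS Thm 1
∘ Ko 7.4, `hC` Ko 7.4 ∘ CS (ii) ⟹ (i) [PRE]; Kobayashi Thm 1.2 / 4.1 `h12`, `h41`; the period facts `h5`, `h3` [PUB]) AND
the FW binder `hFW` (FW Thm 5.1 ∘ Ko 7.4, PRE), the crux `KobayashiLowerHalfLargeImage` BY NAME is EQUIVALENT to: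
(Kim's Conjecture 1.10 `X4.KimTamagawaDefectAt` for the newform of every X7 ∧ ¬CM ∧ `a_p = 0` ∧ Surj pair at `p ≥ 5`
with NO non-split multiplicative prime `ℓ ≠ p` having `p ∤ ord_ℓ(Δ_min)`) ∧ (the crux's own conclusion at the X7@3 ∧
¬CM ∧ `a₃ = 0` ∧ Surj pairs with no such `ℓ`). I.e. along this line EVERY open statement lives off the Fouquet–Wan
locus (the cell's census classes B ∪ C ∪ D ∪ E at `p ≥ 5`), and the re-keying is faithful. CONDITIONAL; closes
nothing; BSD is not proved by any of this. [cite: Kim2022StructureSelmer, Conj. 1.10 (PDF p. 8)]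
[claim: CastellaSano2026, status: under-review] [claim: FouquetWan2021, status: under-review]
[cite: Kobayashi2003, Thm. 1.2 (p. 2), Thm. 4.1 (p. 8), Thm. 7.4 (p. 13)] [cite: GreenbergVatsal2000, §3, Remark 3.4] -/
theorem kobayashiLowerHalfLargeImage_iff_offLocus_of_fw51_OPEN
    (hCS : CastellaSano2026_thm1_via_kobayashi74_OPEN)
    (hC : Kobayashi74_CastellaSano2026_kimTamagawaDefect_of_signedMC_OPEN)
    (h12 : Kobayashi2003.thm12_signedSelmerDual_finite_torsion)
    (h41 : Kobayashi2003.thm41_signedCharIdeal_divisibility)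
    (h5 : realPeriodRat_eq_unit_mul_plusPeriod) (h3 : realPeriodRat_eq_unit_mul_plusPeriod_three)
    (hFW : FouquetWan2021_thm51_via_kobayashi74_OPEN) :
    Summit.BirchSwinnertonDyer.BirchSwinnertonDyer.Theses.SignedLowerHalves.KobayashiLowerHalfLargeImage ↔
      ((∀ (W : WeierstrassCurve ℚ) [W.IsElliptic] [W.IsGloballyMinimal] (p : ℕ) [Fact p.Prime],
          5 ≤ p → ClassX7 W p → ¬ W.HasCM → W.frobeniusTrace p = 0 → Surj W p →
          ¬ (∃ (ℓ : ℕ) (_ : Fact ℓ.Prime), ℓ ≠ p ∧ W.HasMultiplicativeReductionAtPrime ℓ ∧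
              ¬ W.HasSplitMultiplicativeReductionAtPrime ℓ ∧ ¬ p ∣ padicValInt ℓ W.minimalDiscriminantInt) →
          ∀ [NeZero (W.conductorNorm ℤ)] (f : CuspForm (Gamma0 (W.conductorNorm ℤ)) 2),
            IsNewformOf W f → KimTamagawaDefectAt W p f) ∧
        (∀ (W : WeierstrassCurve ℚ) [W.IsElliptic] [W.IsGloballyMinimal] (p : ℕ) [Fact p.Prime],
          p = 3 → ClassX7 W p → ¬ W.HasCM → W.frobeniusTrace p = 0 → Surj W p →
          ¬ (∃ (ℓ : ℕ) (_ : Fact ℓ.Prime), ℓ ≠ p ∧ W.HasMultiplicativeReductionAtPrime ℓ ∧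
              ¬ W.HasSplitMultiplicativeReductionAtPrime ℓ ∧ ¬ p ∣ padicValInt ℓ W.minimalDiscriminantInt) →
          ∃ ε : ℤˣ, KobayashiLowerDivisibility W p ε)) :=
  (kobayashiLowerHalfLargeImage_iff_kimTamagawaDefect_X7 hCS hC h12 h41 h5 h3).trans
    (and_congr (kimTamagawaDefect_X7_iff_offLocus_of_fw51_of_converse_OPEN hFW hC h5)
      (three_iff_offLocus_of_fw51_OPEN hFW))

/-- **THE OFF-LOCUS EQUIVALENCE on PACKAGE-LEVEL named inputs** (no composite binder; Kobayashi Thm 7.4 in the kernel in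
both directions): GRANTED Castella–Sano Thm 1 in both directions on the `η = 1` package (`hCS`, `hCSc`; PREPRINT claims,
never theorems), Fouquet–Wan Thm 5.1 on the package (`hFW`, PREPRINT claim), Kobayashi's package fact (`hPkg`), Pollack
(`hPollack`), modularity (`hmod`), Kobayashi Thm 1.2 (`h12`) and Thm 4.1 (`h41`), the period facts (`h5`, `h3`) — the crux BY
NAME ⟺ (Kim's Conjecture 1.10 at the X7 ∧ ¬CM ∧ `a_p = 0` ∧ Surj ∧ `p ≥ 5` pairs OFF the Fouquet–Wan locus) ∧ (the crux's
conclusion at the X7@3 pairs OFF the locus). CONDITIONAL; closes nothing; BSD is not proved by any of this.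
[claim: CastellaSano2026, status: under-review] [claim: FouquetWan2021, status: under-review]
[cite: Kobayashi2003, Thm. 1.2 (p. 2), Thm. 4.1 (p. 8), Thm. 6.2–6.3 (p. 11), Thm. 7.3–7.4 (p. 13)]
[cite: Pollack2003, Cor. 5.11 and Prop. 6.18] [cite: Kim2022StructureSelmer, Conj. 1.10 (PDF p. 8)]
[cite: GreenbergVatsal2000, §3, Remark 3.4] [cite: Mazur1978, Cor. 4.1] -/
theorem kobayashiLowerHalfLargeImage_iff_offLocus_of_facts
    (hCS : CastellaSano2026.thm1_katoMainIdentity_of_kimTamagawaDefect_OPEN)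
    (hCSc : CastellaSano2026.thm1_kimTamagawaDefect_of_katoMainIdentity_OPEN)
    (hFW : FouquetWan2021.thm51_katoMainIdentity_OPEN)
    (hPkg : Kobayashi2003.thm62_63_73_signedColemanKato_zeta)
    (hPollack : ∀ (W : WeierstrassCurve ℚ) [W.IsElliptic] [W.IsGloballyMinimal] {N : ℕ} [NeZero N]
        (f : CuspForm (Gamma0 N) 2) (p : ℕ) [Fact p.Prime],
        pollack_exists_plusMinusPAdicLFunction (W := W) (f := f) (p := p))
    (hmod : exists_isNewformOf)
    (h12 : Kobayashi2003.thm12_signedSelmerDual_finite_torsion)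
    (h41 : Kobayashi2003.thm41_signedCharIdeal_divisibility)
    (h5 : realPeriodRat_eq_unit_mul_plusPeriod) (h3 : realPeriodRat_eq_unit_mul_plusPeriod_three) :
    Summit.BirchSwinnertonDyer.BirchSwinnertonDyer.Theses.SignedLowerHalves.KobayashiLowerHalfLargeImage ↔
      ((∀ (W : WeierstrassCurve ℚ) [W.IsElliptic] [W.IsGloballyMinimal] (p : ℕ) [Fact p.Prime],
          5 ≤ p → ClassX7 W p → ¬ W.HasCM → W.frobeniusTrace p = 0 → Surj W p →
          ¬ (∃ (ℓ : ℕ) (_ : Fact ℓ.Prime), ℓ ≠ p ∧ W.HasMultiplicativeReductionAtPrime ℓ ∧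
              ¬ W.HasSplitMultiplicativeReductionAtPrime ℓ ∧ ¬ p ∣ padicValInt ℓ W.minimalDiscriminantInt) →
          ∀ [NeZero (W.conductorNorm ℤ)] (f : CuspForm (Gamma0 (W.conductorNorm ℤ)) 2),
            IsNewformOf W f → KimTamagawaDefectAt W p f) ∧
        (∀ (W : WeierstrassCurve ℚ) [W.IsElliptic] [W.IsGloballyMinimal] (p : ℕ) [Fact p.Prime],
          p = 3 → ClassX7 W p → ¬ W.HasCM → W.frobeniusTrace p = 0 → Surj W p →
          ¬ (∃ (ℓ : ℕ) (_ : Fact ℓ.Prime), ℓ ≠ p ∧ W.HasMultiplicativeReductionAtPrime ℓ ∧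
              ¬ W.HasSplitMultiplicativeReductionAtPrime ℓ ∧ ¬ p ∣ padicValInt ℓ W.minimalDiscriminantInt) →
          ∃ ε : ℤˣ, KobayashiLowerDivisibility W p ε)) :=
  kobayashiLowerHalfLargeImage_iff_offLocus_of_fw51_OPEN
    (castellaSano2026_thm1_via_kobayashi74_OPEN_of_facts hCS h12 h5)
    (kobayashi74_castellaSano2026_kimTamagawaDefect_of_signedMC_OPEN_of_facts hCSc hPkg hPollack hmod) h12 h41 h5 h3
    (fouquetWan2021_thm51_via_kobayashi74_OPEN_of_facts hFW h12 h5 h3)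

/-! ## §3 The lead's FINAL composition (p616002) on package-level named inputs only -/

/-- **Crux `KobayashiLowerHalfLargeImage` BY NAME — every binder a PACKAGE-LEVEL named statement, every open statement OFF
the Fouquet–Wan locus or at `3`** (the lead gen 2's `kobayashiLowerHalfLargeImage_of_allBinders_of_offLocus_OPEN`, p616002,
with its five composite binders fed from the seat's `_of_facts` derivations): GRANTED Kim 2026 Thm 1.11 (1) ⟹ (3) on the
`η = 1` package (`hKim`, PUBLISHED), Castella–Sano Thm 1 (i) ⟹ (ii) and (ii) ⟹ (i) on the package (`hCS`, `hCSc`; PREPRINT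
claims), the CS §2 `≥` reading (`hCSge`, PREPRINT reading), KKS Thm 1.1 at `3` on the package (`hKKS3`, claim-grade at `3`,
binder of record p614127), Fouquet–Wan Thm 5.1 on the package (`hFW`, PREPRINT claim), Kobayashi's package fact (`hPkg`),
Pollack (`hPollack`), modularity (`hmod`), Kobayashi Thm 1.2 (`h12`), the period facts (`h5`, `h3`) — and the line's OPEN
statements displayed: `hLeOff` (the `≤` half of Kim's Conjecture 1.10 at the X7 ∧ ¬CM ∧ Surj ∧ `p ≥ 5` pairs OFF the FW
locus), `hU` (Kurihara's conjecture at `3` on the rows X7@3 ∧ ¬CM ∧ Surj ∧ (Tam)₁ ∧ `3 ∤ ∏ c_ℓ`), `hR` (the crux at the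
X7@3 pairs off those rows AND off the locus) — the crux holds. 0 composite binders; Kobayashi Thm 7.4 is a kernel step at
every odd `p`. CONDITIONAL; closes nothing; BSD is not proved by any of this.
[cite: Kim2022StructureSelmer, Thm. 1.11 (1) ⟹ (3) (PDF p. 8), Conj. 1.10] [claim: CastellaSano2026, status: under-review]
[claim: Kim2025RefinedTNC, status: under-review] [cite: KimKimSun2020, Thm. 1.1 (p. 4)]
[claim: FouquetWan2021, status: under-review] [cite: Kobayashi2003, Thm. 1.2 (p. 2), Thm. 6.2–6.3 (p. 11), Thm. 7.3–7.4 (p. 13)]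
[cite: Pollack2003, Cor. 5.11 and Prop. 6.18] [cite: GreenbergVatsal2000, §3, Remark 3.4] [cite: Mazur1978, Cor. 4.1] -/
theorem kobayashiLowerHalfLargeImage_of_packageFacts_of_offLocus_OPEN
    (hKim : Kim2026.thm111_katoMainIdentity_of_kuriharaNumber_ne_zero)
    (hCS : CastellaSano2026.thm1_katoMainIdentity_of_kimTamagawaDefect_OPEN)
    (hCSc : CastellaSano2026.thm1_kimTamagawaDefect_of_katoMainIdentity_OPEN)
    (hCSge : CastellaSano2026_sec2_tamagawaDefectGe_implicit_OPEN)
    (hKKS3 : KimKimSun2020.thm11_katoMainIdentity_of_kuriharaNumber_ne_zero_three_OPEN)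
    (hFW : FouquetWan2021.thm51_katoMainIdentity_OPEN)
    (hPkg : Kobayashi2003.thm62_63_73_signedColemanKato_zeta)
    (hPollack : ∀ (W : WeierstrassCurve ℚ) [W.IsElliptic] [W.IsGloballyMinimal] {N : ℕ} [NeZero N]
        (f : CuspForm (Gamma0 N) 2) (p : ℕ) [Fact p.Prime],
        pollack_exists_plusMinusPAdicLFunction (W := W) (f := f) (p := p))
    (hmod : exists_isNewformOf)
    (h12 : Kobayashi2003.thm12_signedSelmerDual_finite_torsion)
    (h5 : realPeriodRat_eq_unit_mul_plusPeriod) (h3 : realPeriodRat_eq_unit_mul_plusPeriod_three)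
    (hLeOff : ∀ (W : WeierstrassCurve ℚ) [W.IsElliptic] [W.IsGloballyMinimal] (p : ℕ) [Fact p.Prime],
      5 ≤ p → ClassX7 W p → ¬ W.HasCM → W.frobeniusTrace p = 0 → Surj W p →
      ¬ (∃ (ℓ : ℕ) (_ : Fact ℓ.Prime), ℓ ≠ p ∧ W.HasMultiplicativeReductionAtPrime ℓ ∧
          ¬ W.HasSplitMultiplicativeReductionAtPrime ℓ ∧ ¬ p ∣ padicValInt ℓ W.minimalDiscriminantInt) →
      ∀ [NeZero (W.conductorNorm ℤ)] (f : CuspForm (Gamma0 (W.conductorNorm ℤ)) 2),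
        IsNewformOf W f → KimTamagawaDefectLeAt W p f)
    (hU : ∀ (W : WeierstrassCurve ℚ) [W.IsElliptic] [W.IsGloballyMinimal] (p : ℕ) [Fact p.Prime],
      p = 3 → ClassX7 W p → ¬ W.HasCM → W.frobeniusTrace p = 0 → Surj W p → KimKimSun2020TamAt W p →
      ¬ p ∣ W.tamagawaProduct →
      ∀ [NeZero (W.conductorNorm ℤ)] (f : CuspForm (Gamma0 (W.conductorNorm ℤ)) 2),
        IsNewformOf W f → KuriharaUnitAt W p f)
    (hR : ∀ (W : WeierstrassCurve ℚ) [W.IsElliptic] [W.IsGloballyMinimal] (p : ℕ) [Fact p.Prime],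
      p = 3 → ClassX7 W p → ¬ W.HasCM → W.frobeniusTrace p = 0 → Surj W p →
      ¬ (KimKimSun2020TamAt W p ∧ ¬ p ∣ W.tamagawaProduct) →
      ¬ (∃ (ℓ : ℕ) (_ : Fact ℓ.Prime), ℓ ≠ p ∧ W.HasMultiplicativeReductionAtPrime ℓ ∧
          ¬ W.HasSplitMultiplicativeReductionAtPrime ℓ ∧ ¬ p ∣ padicValInt ℓ W.minimalDiscriminantInt) →
      ∃ ε : ℤˣ, KobayashiLowerDivisibility W p ε) :
    Summit.BirchSwinnertonDyer.BirchSwinnertonDyer.Theses.SignedLowerHalves.KobayashiLowerHalfLargeImage :=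
  kobayashiLowerHalfLargeImage_of_allBinders_of_offLocus_OPEN
    (kim2026_thm111_via_kobayashi74_of_facts hKim h12 h5)
    (castellaSano2026_thm1_via_kobayashi74_OPEN_of_facts hCS h12 h5) hCSge
    (kobayashi74_castellaSano2026_kimTamagawaDefect_of_signedMC_OPEN_of_facts hCSc hPkg hPollack hmod) h5
    (kimKimSun2020_thm11_via_kobayashi74_three_of_facts hKKS3 h12 h5 h3) h3
    (fouquetWan2021_thm51_via_kobayashi74_OPEN_of_facts hFW h12 h5 h3) hLeOff hU hR

end Summit.BirchSwinnertonDyer.BirchSwinnertonDyer.Theorems.KuriharaRigidity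

end
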